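import Literature.Analysis.FluidPDE.SwirlTransportProofs
import Literature.Analysis.FluidPDE.ClassicalSolution
import Literature.Analysis.FluidPDE.GavrilovAnsatz
import Literature.Analysis.FluidPDE.AxisymNoSwirlScalarEq
import HarnessLib

/-!
# Crux `AxisymSwirlRegular` (stmt-NavierStokesRegularity-1964), line `radial_inflow_split`, piece X₂
# `AprioriRadialInflowBound`: calculus of the radial momentum `Φ = x₀u₀ + x₁u₁`

`--supports stmt-NavierStokesRegularity-1964` (helper file; theorems only, no definitions).

The birth skeleton `Cruxes/AxisymSwirlRegular/Lines/AprioriRadialInflowBound_birth.lean` of the piece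
X₂ (route item stmt-NavierStokesRegularity-19060) rests on the transport equation of the radial
momentum `Φ := x₀u₀ + x₁u₁ = r u_r` of a classical solution,
`(∂ₜ + u·∇ − νΔ) Φ = (u_r² + u_θ² − r∂ᵣp) + 2ν ∂_z u_z`, and on the observation that for
axisymmetric `u` the term `∂_z u_z = −(x_h·∇_hΦ)/r²` vanishes at a spatial critical point of `Φ`.
This file proves both, in Cartesian form and without division, as the twin of the tree's swirl
calculus (`SwirlTransportProofs.lean`: `Γ = ⟪J y, u y⟫`); here `Φ = ⟪J y, J (u y)⟫` with the same
generator `J v = (−v₁, v₀, 0)`: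

* `fderiv_radialMomentum_apply`, `convect_radialMomentum`, `laplacian_radialMomentum`,
  `hasDerivWithinAt_radialMomentum` / `timeDerivWithin_radialMomentum` — first and second
  derivatives of `Φ` (`ΔΦ = x_h·Δu_h + 2(∂₀u₀ + ∂₁u₁)`);
* `radialMomentum_transport` — for ANY classical Navier–Stokes solution (no symmetry):
  `∂ₜΦ + (u·∇)Φ = ν(ΔΦ − 2(∂₀u₀ + ∂₁u₁)) + (u₀² + u₁²) − (x₀∂₀p + x₁∂₁p) + (x₀f₀ + x₁f₁)`;
* `fderiv_radialMomentum_horizontal_of_isAxisymmetric` — `DΦ(x)[(x₀,x₁,0)] = r²(∂₀u₀ + ∂₁u₁)` for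
  axisymmetric `u` (infinitesimal axisymmetry `Du(x)[Jx] = J u(x)`), whence
  `divH_eq_zero_of_fderiv_radialMomentum_eq_zero` and the critical-point form
  `timeDerivWithin_radialMomentum_of_critical`: at an off-axis critical point of `Φ(t,·)`,
  `∂ₜΦ = νΔΦ + (u₀² + u₁²) − (x₀∂₀p + x₁∂₁p) + (x₀f₀ + x₁f₁)`;
* `laplacian_neg_sub_const` — `Δ(−F − c) = −ΔF`.

All statements are folklore calculus (cf. KNSS 2009 (1.8) for the swirl twin); they feed the
minimum principle of `TypeIIInviscidRelaxationAxisymSwirlRegularInflowMinPrinciple.lean`.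

References: G. Koch, N. Nadirashvili, G. Seregin, V. Šverák, Acta Math. 203 (2009), (1.8)
[KNSS2009]; A. Majda, A. Bertozzi, *Vorticity and Incompressible Flow*, CUP 2002, §2.3.3.
-/

noncomputable section

open Literature.Analysis.FluidPDE Set Function Filter Topology WithLp
open scoped InnerProductSpace RealInnerProductSpace Laplacian ContDiff

namespace Summit.NavierStokesRegularity.NavierStokesRegularity.Theorems

-- the problem directory repeats the summit name (`NavierStokesRegularity/NavierStokesRegularity`)
set_option linter.dupNamespace false

/-! ### Calculus of the radial momentum `Φ = x₀u₀ + x₁u₁ = ⟪J x, J (u x)⟫` -/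

/-- The radial momentum is the pairing `x₀u₀ + x₁u₁ = ⟪J y, J (u y)⟫`. [folklore] -/
theorem radialMomentum_eq_inner_rotGen (u : EuclideanSpace ℝ (Fin 3) → EuclideanSpace ℝ (Fin 3)) :
    (fun y : EuclideanSpace ℝ (Fin 3) => y 0 * u y 0 + y 1 * u y 1) = fun y => ⟪rotGen y, rotGen (u y)⟫ := by
  funext y
  rw [inner_rotGen_rotGen]

/-- `y ↦ J (u y)` has derivative `J ∘ Du(x)`. [folklore] -/
theorem hasFDerivAt_rotGen_comp {u : EuclideanSpace ℝ (Fin 3) → EuclideanSpace ℝ (Fin 3)} {x : EuclideanSpace ℝ (Fin 3)} (hd : DifferentiableAt ℝ u x) :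
    HasFDerivAt (fun y => rotGen (u y)) (rotGenL.comp (fderiv ℝ u x)) x :=
  (hasFDerivAt_rotGen (u x)).comp x hd.hasFDerivAt

/-- **First derivative of the radial momentum** (pairing form):
`DΦ(x)h = ⟪J x, J (Du(x)h)⟫ + ⟪J h, J (u x)⟫`. [folklore] -/
theorem fderiv_radialMomentum_apply_inner {u : EuclideanSpace ℝ (Fin 3) → EuclideanSpace ℝ (Fin 3)} {x : EuclideanSpace ℝ (Fin 3)} (hd : DifferentiableAt ℝ u x)
    (h : EuclideanSpace ℝ (Fin 3)) :
    fderiv ℝ (fun y : EuclideanSpace ℝ (Fin 3) => y 0 * u y 0 + y 1 * u y 1) x h =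
      ⟪rotGen x, rotGen (fderiv ℝ u x h)⟫ + ⟪rotGen h, rotGen (u x)⟫ := by
  rw [radialMomentum_eq_inner_rotGen,
    fderiv_inner_apply ℝ (hasFDerivAt_rotGen x).differentiableAt
      (hasFDerivAt_rotGen_comp hd).differentiableAt,
    (hasFDerivAt_rotGen x).fderiv, (hasFDerivAt_rotGen_comp hd).fderiv]
  simp only [rotGenL_apply, ContinuousLinearMap.coe_comp, Function.comp_apply]

/-- **First derivative of the radial momentum** (coordinates):
`DΦ(x)h = (x₀ (Du h)₀ + x₁ (Du h)₁) + (h₀ u₀ + h₁ u₁)`. [folklore] -/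
theorem fderiv_radialMomentum_apply {u : EuclideanSpace ℝ (Fin 3) → EuclideanSpace ℝ (Fin 3)} {x : EuclideanSpace ℝ (Fin 3)} (hd : DifferentiableAt ℝ u x)
    (h : EuclideanSpace ℝ (Fin 3)) :
    fderiv ℝ (fun y : EuclideanSpace ℝ (Fin 3) => y 0 * u y 0 + y 1 * u y 1) x h =
      (x 0 * fderiv ℝ u x h 0 + x 1 * fderiv ℝ u x h 1) + (h 0 * u x 0 + h 1 * u x 1) := by
  rw [fderiv_radialMomentum_apply_inner hd, inner_rotGen_rotGen, inner_rotGen_rotGen]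

/-- The radial momentum of a `Cⁿ` field is `Cⁿ`. [folklore] -/
theorem contDiff_radialMomentum {u : EuclideanSpace ℝ (Fin 3) → EuclideanSpace ℝ (Fin 3)} {n : WithTop ℕ∞} (hu : ContDiff ℝ n u) :
    ContDiff ℝ n (fun y : EuclideanSpace ℝ (Fin 3) => y 0 * u y 0 + y 1 * u y 1) := by
  rw [radialMomentum_eq_inner_rotGen]
  exact rotGenL.contDiff.inner ℝ (rotGenL.contDiff.comp hu)

/-- **Convective derivative of the radial momentum**:
`(u·∇)Φ = (x₀((u·∇)u)₀ + x₁((u·∇)u)₁) + (u₀² + u₁²)`. [folklore] -/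
theorem convect_radialMomentum {u : EuclideanSpace ℝ (Fin 3) → EuclideanSpace ℝ (Fin 3)} {x : EuclideanSpace ℝ (Fin 3)} (hd : DifferentiableAt ℝ u x) :
    convect u (fun y : EuclideanSpace ℝ (Fin 3) => y 0 * u y 0 + y 1 * u y 1) x =
      (x 0 * convect u u x 0 + x 1 * convect u u x 1) + ((u x 0) ^ 2 + (u x 1) ^ 2) := by
  rw [convect_apply, convect_apply, fderiv_radialMomentum_apply hd]
  ring

/-- **Laplacian of the radial momentum**: `ΔΦ = (x₀(Δu)₀ + x₁(Δu)₁) + 2(∂₀u₀ + ∂₁u₁)` for `C²`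
fields (Leibniz rule for `Φ = ⟪J ·, J u⟫`, `J` linear). [folklore] -/
theorem laplacian_radialMomentum {u : EuclideanSpace ℝ (Fin 3) → EuclideanSpace ℝ (Fin 3)} (hu : ContDiff ℝ 2 u) (x : EuclideanSpace ℝ (Fin 3)) :
    (Δ (fun y : EuclideanSpace ℝ (Fin 3) => y 0 * u y 0 + y 1 * u y 1)) x = (x 0 * (Δ u) x 0 + x 1 * (Δ u) x 1) +
      2 * (fderiv ℝ u x (EuclideanSpace.single 0 1) 0 + fderiv ℝ u x (EuclideanSpace.single 1 1) 1) := by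
  classical
  set b := EuclideanSpace.basisFun (Fin 3) ℝ with hb
  have hb' : ∀ i, b i = EuclideanSpace.single i 1 := fun i => by
    simp [hb]
  have hu1 : Differentiable ℝ u := (hu.of_le one_le_two).differentiable one_ne_zero
  have hDi : ∀ e : EuclideanSpace ℝ (Fin 3), Differentiable ℝ fun y => fderiv ℝ u y e := fun e =>
    ((hu.fderiv_right (m := 1) le_rfl).clm_apply contDiff_const).differentiable one_ne_zero
  have hDiJ : ∀ e : EuclideanSpace ℝ (Fin 3), ∀ y : EuclideanSpace ℝ (Fin 3), HasFDerivAt (fun y => rotGen (fderiv ℝ u y e))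
      (rotGenL.comp (fderiv ℝ (fun y => fderiv ℝ u y e) y)) y := fun e y =>
    (hasFDerivAt_rotGen _).comp y (hDi e y).hasFDerivAt
  -- first derivatives along a fixed vector, as a function of the base point
  have h1 : ∀ e : EuclideanSpace ℝ (Fin 3), (fun y => fderiv ℝ (fun y : EuclideanSpace ℝ (Fin 3) => y 0 * u y 0 + y 1 * u y 1) y e) =
      fun y => ⟪rotGen y, rotGen (fderiv ℝ u y e)⟫ + ⟪rotGen e, rotGen (u y)⟫ := fun e =>
    funext fun y => fderiv_radialMomentum_apply_inner (hu1 y) e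
  -- second derivatives
  have h2 : ∀ e : EuclideanSpace ℝ (Fin 3), fderiv ℝ (fun y => fderiv ℝ (fun y : EuclideanSpace ℝ (Fin 3) => y 0 * u y 0 + y 1 * u y 1) y e) x e =
      ⟪rotGen x, rotGen (fderiv ℝ (fun y => fderiv ℝ u y e) x e)⟫ +
        2 * ⟪rotGen e, rotGen (fderiv ℝ u x e)⟫ := by
    intro e
    rw [h1 e]
    rw [fderiv_fun_add (((hasFDerivAt_rotGen x).differentiableAt).inner ℝ (hDiJ e x).differentiableAt)
        ((differentiableAt_const _).inner ℝ (hasFDerivAt_rotGen_comp (hu1 x)).differentiableAt)]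
    rw [_root_.add_apply,
      fderiv_inner_apply ℝ (hasFDerivAt_rotGen x).differentiableAt (hDiJ e x).differentiableAt,
      fderiv_inner_apply ℝ (differentiableAt_const _) (hasFDerivAt_rotGen_comp (hu1 x)).differentiableAt,
      (hasFDerivAt_rotGen x).fderiv, (hDiJ e x).fderiv, (hasFDerivAt_rotGen_comp (hu1 x)).fderiv,
      fderiv_const_apply]
    simp only [rotGenL_apply, ContinuousLinearMap.coe_comp, Function.comp_apply,
      _root_.zero_apply, inner_zero_left, add_zero]
    ring
  rw [laplacian_eq_sum_fderiv_fderiv b (contDiff_radialMomentum hu) x,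
    Finset.sum_congr rfl fun i _ => h2 (b i), Finset.sum_add_distrib, ← Finset.mul_sum]
  have hsum1 : ∑ i, ⟪rotGen (b i), rotGen (fderiv ℝ u x (b i))⟫ =
      fderiv ℝ u x (EuclideanSpace.single 0 1) 0 + fderiv ℝ u x (EuclideanSpace.single 1 1) 1 := by
    simp [Fin.sum_univ_three, hb', inner_rotGen_rotGen]
  have hJsum : rotGen (∑ i, fderiv ℝ (fun y => fderiv ℝ u y (b i)) x (b i)) =
      ∑ i, rotGen (fderiv ℝ (fun y => fderiv ℝ u y (b i)) x (b i)) := map_sum rotGenL _ _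
  have hsum2 : ∑ i, ⟪rotGen x, rotGen (fderiv ℝ (fun y => fderiv ℝ u y (b i)) x (b i))⟫ =
      x 0 * (Δ u) x 0 + x 1 * (Δ u) x 1 := by
    rw [← inner_sum, ← hJsum, ← laplacian_eq_sum_fderiv_fderiv b hu x, inner_rotGen_rotGen]
  rw [hsum1, hsum2]

/-! ### Time derivative, pressure pairing, and the transport identity -/

/-- **Time derivative of the radial momentum** (one-sided, within the time set):
`∂ₜ(x₀u₀ + x₁u₁) = x₀ ∂ₜu₀ + x₁ ∂ₜu₁`, as a `HasDerivWithinAt` statement. [folklore] -/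
theorem hasDerivWithinAt_radialMomentum {S : Set ℝ} {u : ℝ → EuclideanSpace ℝ (Fin 3) → EuclideanSpace ℝ (Fin 3)} (h : IsSmoothSpaceTimeOn S u)
    {t : ℝ} (ht : t ∈ S) (x : EuclideanSpace ℝ (Fin 3)) :
    HasDerivWithinAt (fun s => x 0 * u s x 0 + x 1 * u s x 1)
      (x 0 * timeDerivWithin S u t x 0 + x 1 * timeDerivWithin S u t x 1) S t := by
  have hd := (h.differentiableWithinAt_time ht x).hasDerivWithinAt
  have key := ((innerSL ℝ (rotGen x)).comp rotGenL).hasFDerivAt.comp_hasDerivWithinAt t hd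
  have e1 : ((innerSL ℝ (rotGen x)).comp rotGenL) ∘ (fun s => u s x) =
      fun s => x 0 * u s x 0 + x 1 * u s x 1 := by
    funext s
    simp only [Function.comp_apply, ContinuousLinearMap.coe_comp, innerSL_apply_apply,
      rotGenL_apply, inner_rotGen_rotGen]
  have e2 : ((innerSL ℝ (rotGen x)).comp rotGenL) (derivWithin (fun s => u s x) S t) =
      x 0 * timeDerivWithin S u t x 0 + x 1 * timeDerivWithin S u t x 1 := by
    simp only [ContinuousLinearMap.coe_comp, Function.comp_apply, innerSL_apply_apply,
      rotGenL_apply, inner_rotGen_rotGen, timeDerivWithin_apply]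
  rw [e1, e2] at key
  exact key

/-- **Time derivative of the radial momentum** (the `timeDerivWithin` form, on a time set of
unique differentiability at `t`). [folklore] -/
theorem timeDerivWithin_radialMomentum {S : Set ℝ} {u : ℝ → EuclideanSpace ℝ (Fin 3) → EuclideanSpace ℝ (Fin 3)} (h : IsSmoothSpaceTimeOn S u)
    {t : ℝ} (ht : t ∈ S) (hS : UniqueDiffWithinAt ℝ S t) (x : EuclideanSpace ℝ (Fin 3)) :
    timeDerivWithin S (fun s y => y 0 * u s y 0 + y 1 * u s y 1) t x =
      x 0 * timeDerivWithin S u t x 0 + x 1 * timeDerivWithin S u t x 1 := by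
  rw [timeDerivWithin_apply]
  exact (hasDerivWithinAt_radialMomentum h ht x).derivWithin hS

/-- **The radial-momentum transport identity** (no symmetry assumed). For a classical Navier–Stokes
solution on `ℝ³ × S` with force `f`, the radial momentum `Φ = x₀u₀ + x₁u₁` satisfies at every
`(t, x) ∈ S × ℝ³`
`∂ₜΦ + (u·∇)Φ = ν (ΔΦ − 2(∂₀u₀ + ∂₁u₁)) + (u₀² + u₁²) − (x₀∂₀p + x₁∂₁p) + (x₀f₀ + x₁f₁)`:
pair the momentum equation with the horizontal position vector (`x₀·(eq. 0) + x₁·(eq. 1)`) and use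
`(u·∇)Φ = x_h·(u·∇)u_h + |u_h|²`, `ΔΦ = x_h·Δu_h + 2 div_h u_h`. (The cylindrical form, for
axisymmetric `u` where `2(∂₀u₀ + ∂₁u₁) = (2/r)∂ᵣΦ`, is the twin of the swirl equation KNSS 2009
(1.8) with the source `u_r² + u_θ² − r∂ᵣp`.) [folklore; cf. KNSS2009 (1.8)] -/
theorem radialMomentum_transport {S : Set ℝ} {ν : ℝ} {f u : ℝ → EuclideanSpace ℝ (Fin 3) → EuclideanSpace ℝ (Fin 3)} {p : ℝ → EuclideanSpace ℝ (Fin 3) → ℝ}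
    (h : IsClassicalNSSolutionOn S ν f u p) {t : ℝ} (ht : t ∈ S) (hS : UniqueDiffWithinAt ℝ S t)
    (x : EuclideanSpace ℝ (Fin 3)) :
    timeDerivWithin S (fun s y => y 0 * u s y 0 + y 1 * u s y 1) t x
      + convect (u t) (fun y : EuclideanSpace ℝ (Fin 3) => y 0 * u t y 0 + y 1 * u t y 1) x =
      ν * ((Δ (fun y : EuclideanSpace ℝ (Fin 3) => y 0 * u t y 0 + y 1 * u t y 1)) x
        - 2 * (fderiv ℝ (u t) x (EuclideanSpace.single 0 1) 0
          + fderiv ℝ (u t) x (EuclideanSpace.single 1 1) 1))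
      + ((u t x 0) ^ 2 + (u t x 1) ^ 2)
      - (x 0 * fderiv ℝ (p t) x (EuclideanSpace.single 0 1)
          + x 1 * fderiv ℝ (p t) x (EuclideanSpace.single 1 1))
      + (x 0 * f t x 0 + x 1 * f t x 1) := by
  have hU2 : ContDiff ℝ 2 (u t) := (h.contDiff_velocity ht).of_le (by norm_cast)
  have hUd : DifferentiableAt ℝ (u t) x := (hU2.of_le one_le_two).differentiable one_ne_zero x
  have hmom0 := congrArg (fun v : EuclideanSpace ℝ (Fin 3) => v 0) (h.momentum t ht x)
  have hmom1 := congrArg (fun v : EuclideanSpace ℝ (Fin 3) => v 1) (h.momentum t ht x)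
  simp only [PiLp.add_apply, PiLp.sub_apply, PiLp.smul_apply, smul_eq_mul] at hmom0 hmom1
  rw [timeDerivWithin_radialMomentum h.smooth_velocity ht hS x, convect_radialMomentum hUd,
    laplacian_radialMomentum hU2 x, ← Gavrilov.AnsatzData.gradient_apply (p t) x 0,
    ← Gavrilov.AnsatzData.gradient_apply (p t) x 1]
  linear_combination x 0 * hmom0 + x 1 * hmom1

/-! ### Axisymmetry: the horizontal divergence at a critical point of `Φ` -/

/-- **Horizontal derivative of the radial momentum of an axisymmetric field**:
`DΦ(x)[(x₀, x₁, 0)] = r² (∂₀u₀ + ∂₁u₁)` (from `DΦ(x)h = x_h·Du(x)h + h_h·u` and the infinitesimal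
axisymmetry `Du(x)[J x] = J u(x)`); the twin of `IsAxisymmetric.fderiv_swirl_horizontal`. [folklore] -/
theorem fderiv_radialMomentum_horizontal_of_isAxisymmetric {u : EuclideanSpace ℝ (Fin 3) → EuclideanSpace ℝ (Fin 3)} (hu : IsAxisymmetric u)
    {x : EuclideanSpace ℝ (Fin 3)} (hd : DifferentiableAt ℝ u x) :
    fderiv ℝ (fun y : EuclideanSpace ℝ (Fin 3) => y 0 * u y 0 + y 1 * u y 1) x (toLp 2 ![x 0, x 1, 0]) =
      cylRadius x ^ 2 * (fderiv ℝ u x (EuclideanSpace.single 0 1) 0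
        + fderiv ℝ u x (EuclideanSpace.single 1 1) 1) := by
  have hJ := hu.fderiv_rotGen hd
  rw [rotGen_eq_sub_single, map_sub, map_smul, map_smul] at hJ
  have hA := congrArg (fun v : EuclideanSpace ℝ (Fin 3) => v 0) hJ
  have hB := congrArg (fun v : EuclideanSpace ℝ (Fin 3) => v 1) hJ
  simp only [PiLp.sub_apply, PiLp.smul_apply, smul_eq_mul, rotGen_apply_zero,
    rotGen_apply_one] at hA hB
  rw [fderiv_radialMomentum_apply hd, toLp_horizontal_eq_add_single, map_add, map_smul, map_smul,
    cylRadius_sq]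
  simp only [PiLp.add_apply, PiLp.smul_apply, smul_eq_mul, PiLp.single_apply]
  simp
  linear_combination x 1 * hA - x 0 * hB

/-- **At a critical point of `Φ` off the axis, the horizontal divergence of an axisymmetric field
vanishes**: `DΦ(x) = 0`, `r(x) ≠ 0` ⟹ `∂₀u₀ + ∂₁u₁ = 0` (hence `∂_z u_z = 0` there if
`div u = 0`). [folklore] -/
theorem divH_eq_zero_of_fderiv_radialMomentum_eq_zero {u : EuclideanSpace ℝ (Fin 3) → EuclideanSpace ℝ (Fin 3)} (hu : IsAxisymmetric u)
    {x : EuclideanSpace ℝ (Fin 3)} (hd : DifferentiableAt ℝ u x) (hx : cylRadius x ≠ 0)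
    (hcrit : fderiv ℝ (fun y : EuclideanSpace ℝ (Fin 3) => y 0 * u y 0 + y 1 * u y 1) x = 0) :
    fderiv ℝ u x (EuclideanSpace.single 0 1) 0 + fderiv ℝ u x (EuclideanSpace.single 1 1) 1 = 0 := by
  have h := fderiv_radialMomentum_horizontal_of_isAxisymmetric hu hd
  rw [hcrit, zero_apply] at h
  have hr : cylRadius x ^ 2 ≠ 0 := pow_ne_zero 2 hx
  exact (mul_eq_zero.1 h.symm).resolve_left hr

/-- **The radial momentum at an off-axis critical point (axisymmetric classical solution).** If
`u t` is axisymmetric and `DΦ(t,·)(x) = 0` at a point `x` off the axis, then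
`∂ₜΦ(t,x) = ν ΔΦ(t,x) + (u₀² + u₁²)(t,x) − (x₀∂₀p + x₁∂₁p)(t,x) + (x₀f₀ + x₁f₁)(t,x)`:
in `radialMomentum_transport` the convective term `DΦ(x)[u] ` and the horizontal divergence vanish.
[folklore] -/
theorem timeDerivWithin_radialMomentum_of_critical {S : Set ℝ} {ν : ℝ} {f u : ℝ → EuclideanSpace ℝ (Fin 3) → EuclideanSpace ℝ (Fin 3)}
    {p : ℝ → EuclideanSpace ℝ (Fin 3) → ℝ} (h : IsClassicalNSSolutionOn S ν f u p) {t : ℝ} (ht : t ∈ S)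
    (hS : UniqueDiffWithinAt ℝ S t) (hax : IsAxisymmetric (u t)) {x : EuclideanSpace ℝ (Fin 3)} (hx : cylRadius x ≠ 0)
    (hcrit : fderiv ℝ (fun y : EuclideanSpace ℝ (Fin 3) => y 0 * u t y 0 + y 1 * u t y 1) x = 0) :
    timeDerivWithin S (fun s y => y 0 * u s y 0 + y 1 * u s y 1) t x =
      ν * (Δ (fun y : EuclideanSpace ℝ (Fin 3) => y 0 * u t y 0 + y 1 * u t y 1)) x
      + ((u t x 0) ^ 2 + (u t x 1) ^ 2)
      - (x 0 * fderiv ℝ (p t) x (EuclideanSpace.single 0 1)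
          + x 1 * fderiv ℝ (p t) x (EuclideanSpace.single 1 1))
      + (x 0 * f t x 0 + x 1 * f t x 1) := by
  have hUd : DifferentiableAt ℝ (u t) x :=
    (((h.contDiff_velocity ht).of_le (by norm_cast) : ContDiff ℝ 1 (u t)).differentiable
      one_ne_zero) x
  have key := radialMomentum_transport h ht hS x
  rw [divH_eq_zero_of_fderiv_radialMomentum_eq_zero hax hUd hx hcrit, convect_apply, hcrit,
    zero_apply] at key
  linear_combination key

/-! ### A Laplacian identity -/


/-- `Δ(−F − c) = −ΔF` for a `C²` function and a constant. [folklore] -/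
theorem laplacian_neg_sub_const {F : EuclideanSpace ℝ (Fin 3) → ℝ} (hF : ContDiff ℝ 2 F) (c : ℝ) (y : EuclideanSpace ℝ (Fin 3)) :
    (Δ (fun z => -F z - c)) y = -(Δ F) y := by
  have h1 : (fun z => -F z - c) = (fun _ : EuclideanSpace ℝ (Fin 3) => -c) - F := by
    funext z
    simp only [Pi.sub_apply]
    ring
  have h2 : (Δ (fun _ : EuclideanSpace ℝ (Fin 3) => -c)) y = 0 := by
    rw [InnerProductSpace.laplacian_eq_iteratedFDeriv_stdOrthonormalBasis]
    simp [iteratedFDeriv_const_of_ne (𝕜 := ℝ) (E := EuclideanSpace ℝ (Fin 3)) two_ne_zero (-c)]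
  rw [h1, ContDiffAt.laplacian_sub contDiffAt_const hF.contDiffAt, h2, zero_sub]

end Summit.NavierStokesRegularity.NavierStokesRegularity.Theorems

end
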